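import Summits.AtomisticToContinuum.Crystallization.Theorems.ChartedZeroExcessLayeredLatticeLiouvilleXS

/-!
# Zero-excess layered lattice Liouville — part XT (lens-2 g59, node «SBGlueD1»): the `η, R`-independent constants of the scheme

Critic rows 1133/1135 (part D «no ∃-hiding beyond the prefix; `AB = const(c₀,C₁,δ,…)·C_g`, `ρ₀ ≥ const`»), leaf (2) `SubWindowBudgetGlueBPG` of
`stmt-AtomisticToContinuum-26636`.

`SBPre` = the constants of the scheme that are fixed BEFORE `K₀, η, R` in the quantifier prefix of `SubWindowBudgetBPG` (`δ, a, C_g`; the UTS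
chart class `κ₀, c₀, C₁`; the floor packages `C_L, κ₁, C_T`; `k₀`; the flux tolerance `ε_f`, the re-charting tolerance `ε`, the range `ϱ`, `A_T, m₀, C_R,
n₁`; the coherence slack target `ds`; the bottom scale `nlo`), its inequalities `SBPre.OK`, and the DERIVED constants: `t_C = 1/(8C_L)`,
`K_w = 504C₁/c₀ + 2`, `K_R`, `ϑ₁ = ω₁ = ds/(2(6C₁(2ϱ/c₀)+8)(53/25))`, the `η`-slopes `cP, cG, cμ2, cΘa, cΘb` of `P₀, G₀, μM², Θa, Θb`
(solving the fixed point `μM² ↔ G₀ ↔ Θa ↔ μM²` by the choice `nlo ≥ 4·Cm·g₁`), the energy constant `AB`, and the thresholds `η₁, R₁`.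
`SBPre.toK Q η R : SBK` is the scheme of XM at registration error `η` and radius `R`; XU proves `(Q.toK η R).OK` for `η ≤ Q.η₁`, `R ≥ Q.R₁`.
-/

noncomputable section

open scoped BigOperators
open Set Function Metric

namespace Summit.AtomisticToContinuum.Crystallization.Theorems.ChartedZeroExcessLayeredLatticeLiouville

/-- ★ the `K₀, η, R`-independent constants of the scheme (module docstring). [this file, g59] -/
structure SBPre where
  (δ a Cg : ℝ)
  (c₀ C₁ κ₀ : ℝ)
  (CL κ₁ CT : ℝ)
  (k₀ : ℕ)
  (εf ε ϱ AT m₀ CR n₁ : ℝ)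
  (ds nlo : ℝ)

namespace SBPre

variable (Q : SBPre)

/-- `tC` (docstring added by the landing lane; see the module docstring). [formal bookkeeping] -/
def tC : ℝ := 1 / (8 * Q.CL)
/-- `Kw` (docstring added by the landing lane; see the module docstring). [formal bookkeeping] -/
def Kw : ℝ := 504 * Q.C₁ / Q.c₀ + 2
/-- `θ₁` (docstring added by the landing lane; see the module docstring). [formal bookkeeping] -/
def θ₁ : ℝ := 2 * (8 * Q.CL * Q.tC ^ 2)
/-- `rN` (docstring added by the landing lane; see the module docstring). [formal bookkeeping] -/
def rN : ℝ := 27 / Q.tC ^ 3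
/-- `Rhist` (docstring added by the landing lane; see the module docstring). [formal bookkeeping] -/
def Rhist : ℝ := 27 * Q.Kw ^ 3 / Q.tC ^ (3 * (Q.k₀ + 1))
/-- `Cm` (docstring added by the landing lane; see the module docstring). [formal bookkeeping] -/
def Cm : ℝ := Q.CL * (2 + 2 * Q.CL) * (2 * Q.rN + 1 / Q.tC ^ 2)
/-- `dA` (docstring added by the landing lane; see the module docstring). [formal bookkeeping] -/
def dA : ℝ := dictA (Q.c₀ / 2) 9
/-- `dAϱ` (docstring added by the landing lane; see the module docstring). [formal bookkeeping] -/
def dAϱ : ℝ := dictA (Q.c₀ / 2) Q.ϱ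
/-- the history budget `Bγ = θ₁^{k₀+1}/(8·Rhist·(2 + 216k₀²Cm))` (`OK.hγ ⇔ γ ≤ Bγ`). -/
def Bγ : ℝ := Q.θ₁ ^ (Q.k₀ + 1) / (8 * (Q.Rhist * (2 + 216 * (Q.k₀ : ℝ) ^ 2 * Q.Cm)))
/-- the coherence tolerances `ϑ₁ = ω₁`. -/
def ϑ₁ : ℝ := Q.ds / (2 * ((6 * Q.C₁ * (2 * Q.ϱ / Q.c₀) + 8) * (53 / 25)))
/-- window ratio `R = K_R·n₀`. -/
def KR : ℝ := 14 * Q.C₁ * Q.Kw + 16 * Q.ϱ + 7 * Q.C₁ * (2 * Q.ϱ / Q.c₀) + 7 * Q.C₁ + 60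
/-- `G₁` (docstring added by the landing lane; see the module docstring). [formal bookkeeping] -/
def G₁ : ℝ := (4 + 8 * Q.CL) * (3 / Q.κ₁ ^ 2) * Q.dA * Q.AT ^ 2 * (1000 * Q.C₁ / (Q.δ ^ 3 * Q.tC ^ 3))
/-- `A₁` (docstring added by the landing lane; see the module docstring). [formal bookkeeping] -/
def A₁ : ℝ := dictA Q.c₀ 8 * (27 * (336 * Q.C₁ * (24 / (Q.c₀ * Q.tC)) / 25) ^ 3)
/-- `A₂` (docstring added by the landing lane; see the module docstring). [formal bookkeeping] -/
def A₂ : ℝ := 2 * (10 / Q.δ + 1) ^ 3 * (9 * Q.Cg) * ((2 * (192 * Q.KR / Q.c₀ + 2) / Q.δ + 1 / 21) * (336 * Q.C₁ / 25)) ^ 3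
/-- `A₃` (docstring added by the landing lane; see the module docstring). [formal bookkeeping] -/
def A₃ : ℝ := 512 / Q.c₀ ^ 2 * (10 / Q.δ + 1) ^ 3
/-- `P₀ = cP·η` (top registration, `OK.hreg`). -/
def cP : ℝ := dictB Q.C₁ Q.δ * (9 * Q.Cg) * (21 / Q.δ) ^ 3 * Q.KR ^ 3
/-- `g₀` (docstring added by the landing lane; see the module docstring). [formal bookkeeping] -/
def g₀ : ℝ := 16 * Q.tC ^ 2 * Q.G₁ * (2 * Q.A₁ * Q.cP + Q.A₂)
/-- `g₁` (docstring added by the landing lane; see the module docstring). [formal bookkeeping] -/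
def g₁ : ℝ := 16 * Q.tC ^ 2 * Q.G₁ * (216 * Q.A₁ + Q.A₃)
/-- `μM² = cμ2·η`. -/
def cμ2 : ℝ := 16 * Q.Cm * Q.cP + 4 * Q.Cm * Q.g₀
/-- `Θa = cΘa·η`. -/
def cΘa : ℝ := Q.A₁ * (2 * Q.cP + 216 * Q.cμ2) + Q.A₂ + Q.A₃ * Q.cμ2
/-- `G₀ = cG·η = 16 t_C² G₁ Θa`. -/
def cG : ℝ := 16 * Q.tC ^ 2 * Q.G₁ * Q.cΘa
/-- `Θb = cΘb·η`. -/
def cΘb : ℝ := Q.A₁ * (2 * Q.cG)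
/-- `pmax = cpm·η`. -/
def cpm : ℝ := Q.cP + Q.cG / Q.nlo ^ 2
/-- ★ the energy constant of `SubWindowBudgetBPG`: `K.ABK = AB·η`. -/
def AB : ℝ :=
  dictA Q.c₀ 8 * (27 * (336 * Q.C₁ * ((24 / Q.c₀ + 1) / Q.tC) / 25) ^ 3) * (2 * Q.cpm + 54 * (4 * Q.cμ2)) +
    2 * (10 / Q.δ + 1) ^ 3 * (8 * Q.Cg) * ((2 * (192 * Q.KR / Q.c₀ + 1) / Q.δ + 1 / 21) * (336 * Q.C₁ / 25)) ^ 3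
/-- smallness target of `μM² = cμ2·η` (drift budget, tear-freeness, coherence slack). -/
def mμ : ℝ := min (min ((Q.c₀ / (2 * Q.CR)) ^ 2) ((Q.κ₀ / (2 * Q.CR)) ^ 2))
  (min (min ((1 / (2000 * Q.CR)) ^ 2) ((Q.c₀ / 16) ^ 2)) ((Q.ds * Q.c₀ / (8 * Q.ϱ)) ^ 2))
/-- smallness target of `pmax = cpm·η` (correction sizes). -/
def mp : ℝ := min (Q.θ₁ / (1728 * Q.CR ^ 2 * Q.Cm ^ 2)) (min (Q.m₀ ^ 2 / Q.Cm) (1 / (4 * Q.CR ^ 2 * Q.Cm)))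
/-- ★ the registration-error threshold of the scheme. -/
def η₁ : ℝ := min (Q.mμ / (Q.cμ2 + 1)) (Q.mp / (Q.cpm + 1))
/-- ★ the radius threshold of the scheme. -/
def R₁ : ℝ := max (Q.KR * Q.nlo) (max (32 * Q.ϱ + 40) (4 * (28 / 25 * (24 + 6 * Q.C₁ * (2 * Q.ϱ / Q.c₀) + 6 * Q.C₁))))

/-- ★ the scheme of XM at registration error `η` and radius `R`. -/
def toK (η R : ℝ) : SBK where
  δ := Q.δ
  a := Q.a
  Cg := Q.Cg
  η := η
  R := R
  c₀ := Q.c₀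
  C₁ := Q.C₁
  κ₀ := Q.κ₀
  CL := Q.CL
  κ₁ := Q.κ₁
  CT := Q.CT
  tC := Q.tC
  Kw := Q.Kw
  KR := Q.KR
  k₀ := Q.k₀
  εf := Q.εf
  ε := Q.ε
  ϱ := Q.ϱ
  AT := Q.AT
  m₀ := Q.m₀
  CR := Q.CR
  n₁ := Q.n₁
  ϑ₁ := Q.ϑ₁
  ω₁ := Q.ϑ₁
  P₀ := Q.cP * η
  G₀ := Q.cG * η
  μM := Real.sqrt (Q.cμ2 * η)
  Θa := Q.cΘa * η
  Θb := Q.cΘb * η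
  nlo := Q.nlo

/-- ★ the inequalities among the `η, R`-independent constants (each one is a CHOICE made in XV from the nine antecedents). [this file, g59] -/
structure OK : Prop where
  (hδ : 0 < Q.δ) (hδ1 : Q.δ ≤ 1) (ha : 0 < Q.a) (hCg : 1 ≤ Q.Cg) (hc₀ : 0 < Q.c₀) (hc₀1 : Q.c₀ ≤ 1) (hcC : Q.c₀ ≤ Q.C₁) (hκ₀ : 0 < Q.κ₀)
  (hCL : 1 ≤ Q.CL) (hκ₁ : 0 < Q.κ₁) (hCT : 0 ≤ Q.CT) (hKwk : Q.Kw * Q.tC ^ Q.k₀ ≤ 1)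
  (hεf : 0 < Q.εf) (hεf1 : Q.εf ≤ 1) (hεfB : (4 + 8 * Q.CL) * (3 / Q.κ₁ ^ 2) * (Q.dA ^ 2 + 1) * Q.εf ≤ Q.Bγ / 2)
  (hε : 0 < Q.ε) (hε1 : Q.ε ≤ 1 / 2) (hεs : 1728 * Q.Cm * Q.ε ^ 2 ≤ Q.θ₁)
  (hϱ : 1 ≤ Q.ϱ) (hAT : 0 ≤ Q.AT) (hm₀ : 0 < Q.m₀) (hCR : 1 ≤ Q.CR) (hn₁ : 0 < Q.n₁)
  (hds : 0 < Q.ds) (hds4 : Q.ds ≤ 1 / 4) (hdsB : (4 + 8 * Q.CL) * (3 / Q.κ₁ ^ 2) * ((1 / 2 * Q.CT * Q.dAϱ) ^ 2 + 1) * Q.ds ≤ Q.Bγ / 2)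
  (hnlo : 1 ≤ Q.nlo) (hnlo₁ : Q.n₁ ≤ Q.nlo) (hnlom : (32 * Q.ϱ + 48) * (18 / Q.c₀) + 2 * Q.ϱ / Q.c₀ + 1 ≤ Q.nlo)
  (hnlot : 8 * Q.ϱ + 10 ≤ Q.C₁ * Q.nlo) (hnloμ : 4 * Q.Cm * Q.g₁ ≤ Q.nlo) (hnloB : 32 * Q.tC ^ 2 * Q.G₁ * Q.A₁ ≤ Q.nlo)

/-! ### XT.2  Signs of the derived constants -/

section Signs

variable {Q}

/-- `C₁_pos` (docstring added by the landing lane; see the module docstring). [formal bookkeeping] -/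
theorem C₁_pos (hQ : Q.OK) : 0 < Q.C₁ := lt_of_lt_of_le hQ.hc₀ hQ.hcC
/-- `tC_pos` (docstring added by the landing lane; see the module docstring). [formal bookkeeping] -/
theorem tC_pos (hQ : Q.OK) : 0 < Q.tC := by unfold tC; have := hQ.hCL; positivity
/-- `tC_le` (docstring added by the landing lane; see the module docstring). [formal bookkeeping] -/
theorem tC_le (hQ : Q.OK) : Q.tC ≤ 1 / 8 := by
  unfold tC; rw [div_le_div_iff₀ (by have := hQ.hCL; positivity) (by norm_num)]; linarith [hQ.hCL]
/-- `two_le_Kw` (docstring added by the landing lane; see the module docstring). [formal bookkeeping] -/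
theorem two_le_Kw (hQ : Q.OK) : 2 ≤ Q.Kw := by
  unfold Kw; have := hQ.hc₀; have := C₁_pos hQ; have : 0 ≤ 504 * Q.C₁ / Q.c₀ := by positivity
  linarith
/-- `θ₁_pos` (docstring added by the landing lane; see the module docstring). [formal bookkeeping] -/
theorem θ₁_pos (hQ : Q.OK) : 0 < Q.θ₁ := by unfold θ₁; have := hQ.hCL; have := tC_pos hQ; positivity
/-- `θ₁_eq` (docstring added by the landing lane; see the module docstring). [formal bookkeeping] -/
theorem θ₁_eq (hQ : Q.OK) : Q.θ₁ = 1 / (4 * Q.CL) := by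
  unfold θ₁ tC; have := hQ.hCL; field_simp; ring
/-- `rN_pos` (docstring added by the landing lane; see the module docstring). [formal bookkeeping] -/
theorem rN_pos (hQ : Q.OK) : 0 < Q.rN := by unfold rN; have := tC_pos hQ; positivity
/-- `Rhist_pos` (docstring added by the landing lane; see the module docstring). [formal bookkeeping] -/
theorem Rhist_pos (hQ : Q.OK) : 0 < Q.Rhist := by unfold Rhist; have := tC_pos hQ; have := two_le_Kw hQ; positivity
/-- `Cm_pos` (docstring added by the landing lane; see the module docstring). [formal bookkeeping] -/
theorem Cm_pos (hQ : Q.OK) : 0 < Q.Cm := by unfold Cm; have := hQ.hCL; have := tC_pos hQ; have := rN_pos hQ; positivity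
/-- `dA_nonneg` (docstring added by the landing lane; see the module docstring). [formal bookkeeping] -/
theorem dA_nonneg (Q : SBPre) : 0 ≤ Q.dA := dictA_nonneg _ _
/-- `dAϱ_nonneg` (docstring added by the landing lane; see the module docstring). [formal bookkeeping] -/
theorem dAϱ_nonneg (Q : SBPre) : 0 ≤ Q.dAϱ := dictA_nonneg _ _
/-- `Bγ_pos` (docstring added by the landing lane; see the module docstring). [formal bookkeeping] -/
theorem Bγ_pos (hQ : Q.OK) : 0 < Q.Bγ := by
  unfold Bγ; have := θ₁_pos hQ; have := Rhist_pos hQ; have := Cm_pos hQ; positivity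
/-- `KR_pos` (docstring added by the landing lane; see the module docstring). [formal bookkeeping] -/
theorem KR_pos (hQ : Q.OK) : 0 < Q.KR := by
  unfold KR; have := hQ.hc₀; have := C₁_pos hQ; have := two_le_Kw hQ; have := hQ.hϱ; positivity
/-- `KR_ge` (docstring added by the landing lane; see the module docstring). [formal bookkeeping] -/
theorem KR_ge (hQ : Q.OK) : 14 * Q.C₁ * Q.Kw ≤ Q.KR ∧ 28 * Q.C₁ ≤ Q.KR := by
  unfold KR; have := hQ.hc₀; have hC := C₁_pos hQ; have hK := two_le_Kw hQ; have := hQ.hϱ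
  have : 0 ≤ 7 * Q.C₁ * (2 * Q.ϱ / Q.c₀) := by positivity
  constructor
  · nlinarith
  · nlinarith
/-- `ϑ₁_pos` (docstring added by the landing lane; see the module docstring). [formal bookkeeping] -/
theorem ϑ₁_pos (hQ : Q.OK) : 0 < Q.ϑ₁ := by
  unfold ϑ₁; have := hQ.hc₀; have := C₁_pos hQ; have := hQ.hϱ; have := hQ.hds; positivity
/-- the coherence tolerances realise half the slack target: `(6C₁(2ϱ/c₀)+8)((28/25)ω₁ + ϑ₁) = ds/2`. -/
theorem ϑ₁_slack (hQ : Q.OK) : (6 * Q.C₁ * (2 * Q.ϱ / Q.c₀) + 8) * (28 / 25 * Q.ϑ₁ + Q.ϑ₁) = Q.ds / 2 := by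
  unfold ϑ₁
  have := hQ.hc₀; have := C₁_pos hQ; have := hQ.hϱ
  have h : 0 < 6 * Q.C₁ * (2 * Q.ϱ / Q.c₀) + 8 := by positivity
  field_simp
  ring
/-- `G₁_nonneg` (docstring added by the landing lane; see the module docstring). [formal bookkeeping] -/
theorem G₁_nonneg (hQ : Q.OK) : 0 ≤ Q.G₁ := by
  unfold G₁; have := hQ.hCL; have := hQ.hAT; have := hQ.hδ; have := tC_pos hQ; have := C₁_pos hQ; have := dA_nonneg Q; positivity
/-- `A₁_nonneg` (docstring added by the landing lane; see the module docstring). [formal bookkeeping] -/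
theorem A₁_nonneg (hQ : Q.OK) : 0 ≤ Q.A₁ := by
  unfold A₁; have := hQ.hc₀; have := C₁_pos hQ; have := tC_pos hQ; have := dictA_nonneg Q.c₀ 8; positivity
/-- `A₂_nonneg` (docstring added by the landing lane; see the module docstring). [formal bookkeeping] -/
theorem A₂_nonneg (hQ : Q.OK) : 0 ≤ Q.A₂ := by
  unfold A₂; have := hQ.hc₀; have := C₁_pos hQ; have := hQ.hδ; have := hQ.hCg; have := KR_pos hQ; positivity
/-- `A₃_nonneg` (docstring added by the landing lane; see the module docstring). [formal bookkeeping] -/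
theorem A₃_nonneg (hQ : Q.OK) : 0 ≤ Q.A₃ := by unfold A₃; have := hQ.hc₀; have := hQ.hδ; positivity
/-- `dictB_nonneg'` (docstring added by the landing lane; see the module docstring). [formal bookkeeping] -/
theorem dictB_nonneg' (hQ : Q.OK) : 0 ≤ dictB Q.C₁ Q.δ := by
  unfold dictB; have := hQ.hδ; have := C₁_pos hQ; positivity
/-- `cP_nonneg` (docstring added by the landing lane; see the module docstring). [formal bookkeeping] -/
theorem cP_nonneg (hQ : Q.OK) : 0 ≤ Q.cP := by
  unfold cP; have := hQ.hδ; have := hQ.hCg; have := KR_pos hQ; have := dictB_nonneg' hQ; positivity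
/-- `g₀_nonneg` (docstring added by the landing lane; see the module docstring). [formal bookkeeping] -/
theorem g₀_nonneg (hQ : Q.OK) : 0 ≤ Q.g₀ := by
  unfold g₀; have := tC_pos hQ; have := G₁_nonneg hQ; have := A₁_nonneg hQ; have := A₂_nonneg hQ; have := cP_nonneg hQ; positivity
/-- `g₁_nonneg` (docstring added by the landing lane; see the module docstring). [formal bookkeeping] -/
theorem g₁_nonneg (hQ : Q.OK) : 0 ≤ Q.g₁ := by
  unfold g₁; have := tC_pos hQ; have := G₁_nonneg hQ; have := A₁_nonneg hQ; have := A₃_nonneg hQ; positivity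
/-- `cμ2_nonneg` (docstring added by the landing lane; see the module docstring). [formal bookkeeping] -/
theorem cμ2_nonneg (hQ : Q.OK) : 0 ≤ Q.cμ2 := by
  unfold cμ2; have := Cm_pos hQ; have := cP_nonneg hQ; have := g₀_nonneg hQ; positivity
/-- `cΘa_nonneg` (docstring added by the landing lane; see the module docstring). [formal bookkeeping] -/
theorem cΘa_nonneg (hQ : Q.OK) : 0 ≤ Q.cΘa := by
  unfold cΘa; have := A₁_nonneg hQ; have := A₂_nonneg hQ; have := A₃_nonneg hQ; have := cP_nonneg hQ; have := cμ2_nonneg hQ; positivity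
/-- `cG_nonneg` (docstring added by the landing lane; see the module docstring). [formal bookkeeping] -/
theorem cG_nonneg (hQ : Q.OK) : 0 ≤ Q.cG := by
  unfold cG; have := tC_pos hQ; have := G₁_nonneg hQ; have := cΘa_nonneg hQ; positivity
/-- the fixed-point identity `cG = g₀ + g₁·cμ2`. -/
theorem cG_eq (Q : SBPre) : Q.cG = Q.g₀ + Q.g₁ * Q.cμ2 := by unfold cG g₀ g₁ cΘa; ring
/-- `cΘb_nonneg` (docstring added by the landing lane; see the module docstring). [formal bookkeeping] -/
theorem cΘb_nonneg (hQ : Q.OK) : 0 ≤ Q.cΘb := by unfold cΘb; have := A₁_nonneg hQ; have := cG_nonneg hQ; positivity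
/-- `cpm_nonneg` (docstring added by the landing lane; see the module docstring). [formal bookkeeping] -/
theorem cpm_nonneg (hQ : Q.OK) : 0 ≤ Q.cpm := by
  unfold cpm; have := cP_nonneg hQ; have := cG_nonneg hQ; have := hQ.hnlo; positivity
/-- `AB_nonneg` (docstring added by the landing lane; see the module docstring). [formal bookkeeping] -/
theorem AB_nonneg (hQ : Q.OK) : 0 ≤ Q.AB := by
  unfold AB
  have := hQ.hc₀; have := C₁_pos hQ; have := tC_pos hQ; have := dictA_nonneg Q.c₀ 8; have := hQ.hδ; have := hQ.hCg; have := KR_pos hQ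
  have := cpm_nonneg hQ; have := cμ2_nonneg hQ
  positivity
/-- `mμ_pos` (docstring added by the landing lane; see the module docstring). [formal bookkeeping] -/
theorem mμ_pos (hQ : Q.OK) : 0 < Q.mμ := by
  unfold mμ; have := hQ.hc₀; have := hQ.hκ₀; have := hQ.hCR; have := hQ.hds; have := hQ.hϱ
  refine lt_min (lt_min (by positivity) (by positivity)) (lt_min (lt_min (by positivity) (by positivity)) (by positivity))
/-- `mp_pos` (docstring added by the landing lane; see the module docstring). [formal bookkeeping] -/
theorem mp_pos (hQ : Q.OK) : 0 < Q.mp := by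
  unfold mp; have := θ₁_pos hQ; have := hQ.hCR; have := Cm_pos hQ; have := hQ.hm₀
  exact lt_min (by positivity) (lt_min (by positivity) (by positivity))
/-- `η₁_pos` (docstring added by the landing lane; see the module docstring). [formal bookkeeping] -/
theorem η₁_pos (hQ : Q.OK) : 0 < Q.η₁ := by
  unfold η₁; have := mμ_pos hQ; have := mp_pos hQ; have := cμ2_nonneg hQ; have := cpm_nonneg hQ
  exact lt_min (by positivity) (by positivity)
/-- `R₁_pos` (docstring added by the landing lane; see the module docstring). [formal bookkeeping] -/
theorem R₁_pos (hQ : Q.OK) : 0 < Q.R₁ := by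
  unfold R₁; have := hQ.hϱ
  exact lt_max_of_lt_right (lt_max_of_lt_left (by linarith))
/-- below the threshold, `cμ2·η ≤ mμ` and `cpm·η ≤ mp`. -/
theorem small_of_le_η₁ (hQ : Q.OK) {η : ℝ} (hη : 0 ≤ η) (h : η ≤ Q.η₁) : Q.cμ2 * η ≤ Q.mμ ∧ Q.cpm * η ≤ Q.mp := by
  have h1 : η ≤ Q.mμ / (Q.cμ2 + 1) := h.trans (min_le_left _ _)
  have h2 : η ≤ Q.mp / (Q.cpm + 1) := h.trans (min_le_right _ _)
  have hc := cμ2_nonneg hQ; have hp := cpm_nonneg hQ; have := mμ_pos hQ; have := mp_pos hQ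
  rw [le_div_iff₀ (by positivity)] at h1 h2
  constructor
  · nlinarith
  · nlinarith

end Signs

end SBPre

end Summit.AtomisticToContinuum.Crystallization.Theorems.ChartedZeroExcessLayeredLatticeLiouville

end
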